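import Summits.QuantumFields.YangMills.Theorems.BalabanLadderInfVolFloorsDefs
import Summits.QuantumFields.YangMills.Theorems.BalabanLadderInfVolFloorsCore
import Summits.QuantumFields.YangMills.Theorems.BalabanLadderInfVolCeilings
import HarnessLib

/-!
# The volume-free non-triviality floors: `LowerBounds ⇒ LowerBoundsTL`, monotonicity, summability, and the reading
# against the spine `UV ∧ UVSeamRec` (floors AND ceilings in infinite volume)

HONEST FRAMING (R136 (i) «parallel continuum programme», seat `ym-infvol-p1`, pre-birth helper; bears on the spine route
`BalabanLadder`: `UV` = stmt-QuantumFields-19351, `UVSeamRec` = stmt-QuantumFields-20043, `NT` = stmt-QuantumFields-19353).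
Soft theorems over the NAMED volume-free floors of `Theorems/BalabanLadderInfVolFloorsDefs.lean` (`Q2State`, `Q3State`,
`LowerBoundsOn/TL/IV/DLR`); the torus floors `LowerBounds G r a` are a HYPOTHESIS (dimensional transmutation, barrier
`PerturbativeInvisibility`); §4 consumes the spine's OPEN items `UV`, `UVSeamRec` BY NAME as hypotheses.  Nothing about
Yang–Mills is asserted.  Existence half of the continuum programme only; not a gap, not Clay.

* §1 `LowerBoundsOn.anti`, `lowerBoundsIV_of_lowerBoundsDLR`, `lowerBoundsTL_of_lowerBoundsIV` (DLR ⇒ IV ⇒ TL).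
* §2 `summable_q2State` / `summable_q3State` — the series defining `Q2State` / `Q3State` converge absolutely for every
  probability measure (`s > 0`), so the `tsum`s are genuine sums (no junk value).
* §3 **`lowerBoundsTL_of_lowerBounds`** — `(∀ β, 0 < a β) → LowerBounds G r a → LowerBoundsTL G r a`, same witnesses and
  `ε`: the raw passage `lowerBounds_oddTorusLimitPoints` (Theorems/BalabanLadderInfVolFloorsCore.lean, Tannery along the
  torus-projective family) read through the names.
* §4 **`legsTL_of_uv_uvSeamRec`** — AGAINST THE SPINE BY NAME: `BalabanLadder.UV → BalabanLadder.UVSeamRec →` for every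
  compact simple `G ≃ₜ* SU(2)` ONE lattice representation `r` carrying, in the two-loop unit of record
  `uRec β = exp (FemtoTransferGap.sizeLog β 1)`, the torus legs `LowerBounds`, `MomentBounds6` AND their thermodynamic-limit
  forms `LowerBoundsTL`, `MomentBounds6TL` — the complete E0′ + non-triviality input of an «`L → ∞` first» continuum route.

References: K. Osterwalder, E. Seiler, Ann. Phys. 110 (1978) §2; E. Seiler, LNP 159 (1982) Ch. 2; A. Jaffe, E. Witten
(2006) §5–§6.
-/

set_option autoImplicit false

noncomputable section

open MeasureTheory Filter Topology
open scoped BigOperators SchwartzMap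
open Literature.MathematicalPhysics.QuantumFieldTheory hiding ZdEdge
open Literature.MathematicalPhysics.QuantumLattice
open Literature.Probability.LatticeModels (Site)
open Summit.QuantumFields.YangMills.Cruxes.OSLegsFromFemtoAndGap.DlrCollarTransfer

namespace Summit.QuantumFields.YangMills.Theorems.InfiniteVolume

/-! ## §1 Monotonicity in the family of states -/

section Mono

variable {G : Type} [Group G] [TopologicalSpace G] [IsTopologicalGroup G] [CompactSpace G]
  [MeasurableSpace G] [BorelSpace G] (r : LatticeRep G) (a : ℝ → ℝ)

/-- The volume-free floors are antitone in the family of states (same witnesses and constants). [folklore] -/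
theorem LowerBoundsOn.anti {S S' : ℝ → Set (Measure (LGConfig 4 G))} (hSS' : ∀ β, S β ⊆ S' β)
    (h : LowerBoundsOn G r a S') : LowerBoundsOn G r a S := by
  obtain ⟨⟨v, ε, β₅, hv, hε, H2⟩, ⟨f, g, k, ε', β₆, hfg, hgk, hfk, hε', H3⟩⟩ := h
  exact ⟨⟨v, ε, β₅, hv, hε, fun β hβ μ hμ => H2 β hβ μ (hSS' β hμ)⟩,
    ⟨f, g, k, ε', β₆, hfg, hgk, hfk, hε', fun β hβ μ hμ => H3 β hβ μ (hSS' β hμ)⟩⟩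

/-- **DLR ⇒ IV** for the floors (torus limit states are DLR states, Georgii Thm. 4.17). [folklore] -/
theorem lowerBoundsIV_of_lowerBoundsDLR (h : LowerBoundsDLR G r a) : LowerBoundsIV G r a := by
  haveI : SecondCountableTopology G :=
    (r.continuous.isClosedEmbedding r.injective).isEmbedding.secondCountableTopology
  haveI : T2Space G := (r.continuous.isClosedEmbedding r.injective).isEmbedding.t2Space
  exact LowerBoundsOn.anti r a
    (fun β μ hμ => mem_ymGibbsMeasures_of_mem_infiniteVolumeLimitPoints_holds (d := 4) (ρ := r.ρ) r.continuous hμ) h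

/-- **IV ⇒ TL** for the floors. [folklore] -/
theorem lowerBoundsTL_of_lowerBoundsIV (h : LowerBoundsIV G r a) : LowerBoundsTL G r a :=
  LowerBoundsOn.anti r a (oddTorusLimitPoints_subset r) h

end Mono

/-! ## §2 The series behind `Q2State` / `Q3State` converge absolutely -/

section Summable

variable {G : Type} [Group G] [TopologicalSpace G] [IsTopologicalGroup G] [CompactSpace G]
  [MeasurableSpace G] [BorelSpace G] (r : LatticeRep G)

/-- The covariance of the action densities in a probability state is bounded by `2C²`. [folklore] -/
theorem abs_stateCov_le {C : ℝ} (hC0 : 0 ≤ C) (hC : ∀ (x : Site 4) (U : LGConfig 4 G), |dens G r x U| ≤ C)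
    (μ : Measure (LGConfig 4 G)) [IsProbabilityMeasure μ] (x y : Site 4) : |stateCov G r μ x y| ≤ 2 * C ^ 2 := by
  unfold stateCov
  have h1 : |∫ U, dens G r x U * dens G r y U ∂μ| ≤ C * C :=
    abs_integral_le_of_abs_le fun U => by rw [abs_mul]; exact mul_le_mul (hC x U) (hC y U) (abs_nonneg _) hC0
  have h2 : |(∫ U, dens G r x U ∂μ) * ∫ U, dens G r y U ∂μ| ≤ C * C := by
    rw [abs_mul]
    exact mul_le_mul (abs_integral_le_of_abs_le (hC x)) (abs_integral_le_of_abs_le (hC y)) (abs_nonneg _) hC0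
  calc _ ≤ |∫ U, dens G r x U * dens G r y U ∂μ| + |(∫ U, dens G r x U ∂μ) * ∫ U, dens G r y U ∂μ| := abs_sub _ _
    _ ≤ C * C + C * C := add_le_add h1 h2
    _ = 2 * C ^ 2 := by ring

/-- **`Q2State` is a genuine sum**: its series converges absolutely in every probability state (`s > 0`). [folklore] -/
theorem summable_q2State (μ : Measure (LGConfig 4 G)) [IsProbabilityMeasure μ] {s : ℝ} (hs : 0 < s) (f g : 𝓢(EuclideanSpace ℝ (Fin 4), ℝ)) :
    Summable fun p : Site 4 × Site 4 => f (s • siteToE p.1) * g (s • siteToE p.2) * stateCov G r μ p.1 p.2 := by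
  obtain ⟨C, hC0, hC⟩ := exists_abs_dens_le_uniform (G := G) r
  refine Summable.of_norm_bounded ((summable_abs_pairWeight f g hs).mul_right (2 * C ^ 2)) fun p => ?_
  rw [Real.norm_eq_abs, abs_mul]
  exact mul_le_mul_of_nonneg_left (abs_stateCov_le r hC0 hC μ p.1 p.2) (abs_nonneg _)

/-- The third cumulant of the action densities in a probability state is bounded by `6C³`. [folklore] -/
theorem abs_stateK3_le {C : ℝ} (hC0 : 0 ≤ C) (hC : ∀ (x : Site 4) (U : LGConfig 4 G), |dens G r x U| ≤ C)
    (μ : Measure (LGConfig 4 G)) [IsProbabilityMeasure μ] (x y z : Site 4) : |stateK3 G r μ x y z| ≤ 6 * C ^ 3 := by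
  have hE1 : ∀ w : Site 4, |∫ U, dens G r w U ∂μ| ≤ C := fun w => abs_integral_le_of_abs_le (hC w)
  have hE2 : ∀ v w : Site 4, |∫ U, dens G r v U * dens G r w U ∂μ| ≤ C * C := fun v w =>
    abs_integral_le_of_abs_le fun U => by rw [abs_mul]; exact mul_le_mul (hC v U) (hC w U) (abs_nonneg _) hC0
  have hE3 : |∫ U, dens G r x U * dens G r y U * dens G r z U ∂μ| ≤ C * C * C :=
    abs_integral_le_of_abs_le fun U => by
      rw [abs_mul, abs_mul]
      exact mul_le_mul (mul_le_mul (hC x U) (hC y U) (abs_nonneg _) hC0) (hC z U) (abs_nonneg _)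
        (mul_nonneg hC0 hC0)
  have hm : ∀ (s v w : Site 4), |(∫ U, dens G r s U ∂μ) * ∫ U, dens G r v U * dens G r w U ∂μ| ≤ C * (C * C) := by
    intro s v w
    rw [abs_mul]
    exact mul_le_mul (hE1 s) (hE2 v w) (abs_nonneg _) hC0
  have h4 : |2 * ((∫ U, dens G r x U ∂μ) * (∫ U, dens G r y U ∂μ) * ∫ U, dens G r z U ∂μ)| ≤ 2 * (C * C * C) := by
    rw [abs_mul, abs_of_pos (two_pos : (0 : ℝ) < 2), abs_mul, abs_mul]
    exact mul_le_mul_of_nonneg_left (mul_le_mul (mul_le_mul (hE1 x) (hE1 y) (abs_nonneg _) hC0) (hE1 z)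
      (abs_nonneg _) (mul_nonneg hC0 hC0)) two_pos.le
  unfold stateK3
  calc _ ≤ |(∫ U, dens G r x U * dens G r y U * dens G r z U ∂μ)
          - (∫ U, dens G r x U ∂μ) * (∫ U, dens G r y U * dens G r z U ∂μ)
          - (∫ U, dens G r y U ∂μ) * (∫ U, dens G r x U * dens G r z U ∂μ)
          - (∫ U, dens G r z U ∂μ) * (∫ U, dens G r x U * dens G r y U ∂μ)| +
        |2 * ((∫ U, dens G r x U ∂μ) * (∫ U, dens G r y U ∂μ) * ∫ U, dens G r z U ∂μ)| := abs_add_le _ _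
    _ ≤ (C * C * C + C * (C * C) + C * (C * C) + C * (C * C)) + 2 * (C * C * C) := by
        gcongr
        exact (abs_sub _ _).trans (add_le_add ((abs_sub _ _).trans (add_le_add ((abs_sub _ _).trans
          (add_le_add hE3 (hm x y z))) (hm y x z))) (hm z x y))
    _ = 6 * C ^ 3 := by ring

/-- **`Q3State` is a genuine sum**: its series converges absolutely in every probability state (`s > 0`). [folklore] -/
theorem summable_q3State (μ : Measure (LGConfig 4 G)) [IsProbabilityMeasure μ] {s : ℝ} (hs : 0 < s)
    (f g h : 𝓢(EuclideanSpace ℝ (Fin 4), ℝ)) :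
    Summable fun p : Site 4 × Site 4 × Site 4 =>
      f (s • siteToE p.1) * g (s • siteToE p.2.1) * h (s • siteToE p.2.2) * stateK3 G r μ p.1 p.2.1 p.2.2 := by
  obtain ⟨C, hC0, hC⟩ := exists_abs_dens_le_uniform (G := G) r
  refine Summable.of_norm_bounded ((summable_abs_tripleWeight f g h hs).mul_right (6 * C ^ 3)) fun p => ?_
  rw [Real.norm_eq_abs, abs_mul]
  exact mul_le_mul_of_nonneg_left (abs_stateK3_le r hC0 hC μ p.1 p.2.1 p.2.2) (abs_nonneg _)

end Summable

/-! ## §3 The floors pass to the odd-torus thermodynamic limit states -/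

section Passage

variable {G : Type} [Group G] [TopologicalSpace G] [IsTopologicalGroup G] [CompactSpace G]
  [MeasurableSpace G] [BorelSpace G] (r : LatticeRep G)

/-- **`LowerBounds ⇒ LowerBoundsTL`** for a positive unit map, with the SAME witnesses `v`, `f, g, h` and the same `ε`:
the raw passage `lowerBounds_oddTorusLimitPoints` read through the names `Q2State`, `Q3State`, `LowerBoundsTL`
(definitionally the same text, `lowerBoundsTL_iff`). [folklore] -/
theorem lowerBoundsTL_of_lowerBounds {a : ℝ → ℝ} (hapos : ∀ β, 0 < a β) (h : LowerBounds G r a) :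
    LowerBoundsTL G r a :=
  lowerBounds_oddTorusLimitPoints r hapos h

end Passage

/-! ## §4 Against the spine: floors and ceilings in infinite volume from `UV ∧ UVSeamRec` by name -/

section Spine

/-- **All four infinite-volume-ready legs from the spine's `UV` and `UVSeamRec` BY NAME.**  IF Bałaban's apex package
holds at the datum of record (`Theses.BalabanLadder.UV`, stmt-QuantumFields-19351) and the seam at the unit of record holds
(`Theses.BalabanLadder.UVSeamRec`, stmt-QuantumFields-20043), THEN for every compact simple `G ≃ₜ* SU(2)` (Borel
σ-algebra) ONE lattice representation `r` carries, in the two-loop unit of record `uRec β = exp (sizeLog β 1)`: the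
torus floors `LowerBounds G r uRec`, the torus ceilings `MomentBounds6 G r uRec`, and their thermodynamic-limit forms
`LowerBoundsTL G r uRec` (non-triviality input) and `MomentBounds6TL G r uRec` (E0′ input) for every odd-torus limit
state.  Pure composition (`lowerBoundsTL_of_lowerBounds`, `momentBounds6TL_of_momentBounds6`; `uRec > 0`); both
hypotheses are OPEN items — nothing about Yang–Mills is asserted. [folklore] -/
theorem legsTL_of_uv_uvSeamRec (hUV : Summit.QuantumFields.YangMills.Theses.BalabanLadder.UV)
    (hSeam : Summit.QuantumFields.YangMills.Theses.BalabanLadder.UVSeamRec)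
    (G : Type) [Group G] [TopologicalSpace G] [IsTopologicalGroup G] [CompactSpace G]
    (hG : IsCompactSimpleLieGroup G) (hcl : Nonempty (G ≃ₜ* Matrix.specialUnitaryGroup (Fin 2) ℂ)) :
    letI : MeasurableSpace G := borel G
    haveI : BorelSpace G := ⟨rfl⟩
    ∃ r : LatticeRep G,
      LowerBounds G r (fun β => Real.exp (Summit.QuantumFields.YangMills.Theorems.FemtoTransferGap.sizeLog β 1)) ∧
        MomentBounds6 G r (fun β => Real.exp (Summit.QuantumFields.YangMills.Theorems.FemtoTransferGap.sizeLog β 1)) ∧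
        LowerBoundsTL G r (fun β => Real.exp (Summit.QuantumFields.YangMills.Theorems.FemtoTransferGap.sizeLog β 1)) ∧
        MomentBounds6TL G r
          (fun β => Real.exp (Summit.QuantumFields.YangMills.Theorems.FemtoTransferGap.sizeLog β 1)) := by
  letI : MeasurableSpace G := borel G
  haveI : BorelSpace G := ⟨rfl⟩
  obtain ⟨r, hlb, hmb⟩ := hSeam hUV G hG hcl
  exact ⟨r, hlb, hmb, lowerBoundsTL_of_lowerBounds r (fun β => Real.exp_pos _) hlb, momentBounds6TL_of_momentBounds6 r hmb⟩

end Spine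

end Summit.QuantumFields.YangMills.Theorems.InfiniteVolume

end
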